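import Summits.QuantumFields.YangMills.Theorems.BalabanUVNodesN19MultiplicityByName
import Summits.QuantumFields.YangMills.Theorems.BalabanUVNodesSpineRates
import Summits.QuantumFields.YangMills.Theorems.BalabanUVNodesN19AtSpineCarriers

/-!
# BalabanUVNodes ∕ N19 — the N19′ «RATE EDGE» AT THE TWO CARRIER RECORDS in module 2's letters: from a LINK READING of the pair
# (spine carriers `S`, rate carriers `R`) and K4's conclusion `RatesAt D R` BY NAME (`N14At` · `N18At` · `N22At` consumed; `N16At` ·
# `N17At` through displayed liaison readings) to «`SRec … S → RRec … R → RatesAt D R → ∃ δ, NE7.Core … δ ∧ Summable δ`» — the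
# hypothesis of N27's top join `coreEdge_of_rateEdge` ∕ `ladderUV_of_K4K5stubs_coreEdge` (p419034) (seat dag-n19-a gen 3; count-neutral)

HONEST FRAMING.  NE7 is NOT PRINTED and NOT proved.  Module 2 of the route package (`BalabanUVNodesSpineRates`, p418381) types cluster K4's
conclusion per string as `RatesAt D R = N14At R.ne1 ∧ N15At R.ne2 ∧ N16At R.ne3 ∧ N17At D R.u3 ∧ N18At R.u3 ∧ N22At R.u3` on a bundle
`R : RateCarriers N`, and dag-n27-a's XIV closes the rung from the K1–K5 stubs GIVEN the N19′ rate edge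
«`∀ F D g₀ os S R, SRec F D g₀ os S → RRec F D g₀ os R → RatesAt D R → ∃ δ, NE7.Core (S-cores) δ ∧ Summable δ`».  THIS FILE produces
that edge from this seat's knit chain (v6 `N19MultiplicityByName.core_summable_of_ledgerAtSync_multByName`, p420073): the pair of record
predicates must hand, per `(S, R)`, a LINK READING (§2's `hlink`) over node U3's carriers OF `R` — `R.u3.C`, `R.u3.EA`, run B's
first-coupling family `R.u3.EB` through a SELECTOR `bsel` (§1), the window `R.u3.W`, `R.u3.κ ∕ θ ∕ C₅ ∕ Λ ∕ C₉ ∕ ω ∕ γ`, and N14's tower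
`R.ne1.𝒯` with its count rate `≤ R.ne1.Λ` —: (i) the synchronised ledger predicate `LedgerAtSync` FOR WHATEVER size data and census constants
meet their clauses (= its fields other than size, the two censuses, base signs: the (2.25) TERM FORMAT, reference-ledger inclusion∕scales,
BOOKING, other kinds, rate ordering, `one` — cell NODE O), `0 ≤ S.vol`, the recent U5b ledger's own window census; (ii) the identifications
(v-A)(v-B)(d)(m) of v5∕v6; (iii) [III] Thm 2 (2.43) AS PRINTED (`B14.Thm2Printed`) with window letters and run offset; (iv) the positional-count
half of N14's pinned pair; (v) the LIAISON READINGS — N16 as `NE3Shape Rd C₃ θ₃ ∧ GaugeDominated Rd uA uB` on a readings family `Rd` (the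
venue's `N16At R.ne3 = NE3EnergyRateWCov …` reaches this shape through dag-n16-a's `ne3Shape_of_n16` under regime letters; the gauge
liaison is a realisation convention), N17 as node U2's OUTPUT `InjectedRate Cd 0 θc (disc (g K) (g (K+1)))` on the box with both runs'
tables in the window (the venue's `N17At D R.u3 = NE4OnData …` reaches it under the prefix through dag-n17-a's `nodeU2_of_N17` ∕ dag-n27-a's
`injectedRate_shift`), the bracket (T) `LipBackground R.u3.EA R.u3.W R.u3.κ CU ∧ PolyLipGrowth CU g Pg q` ([III] (2.27)(ii)–(2.28), printed-
grade), the selector's window compatibility, letter signs.  THEN `RatesAt D R` supplies N14 (`N14At R.ne1`), N18 (`N18At R.u3`, at the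
selected first coupling) and N22 (`N22At R.u3`) BY NAME, and v6 yields the edge.

LOCATED TYPING NOTE «run B's first coupling» (pub-ymgap INBOX [DAGN19A-G3-INTENT-4]).  The knit chain carries ONE run-B functional applied
to the SHIFTED coupling table `fun i => g (K+1) (i+1)`; module 2's `U3Carriers.EB : ℝ → Functional` is run B's FIRST-COUPLING family, so the
functional of record at cutoff `K` is `R.u3.EB (g (K+1) 0)`, K-dependent through run B's bare coupling.  `N18At` gives the NE5 letters
UNIFORMLY in the first coupling, so nothing analytic is missing; §1's selector `bsel : (ℕ → ℝ) → ℝ` with `EB := fun s => R.u3.EB (bsel s) s`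
bridges the typing (`ne5_of_n18At`), at the price of ONE displayed identification inside the record's term format: «first-coupling recovery»
`bsel (fun i => g (K+1) (i+1)) = g (K+1) 0` (at the flows of record the (0.20) step `1∕g₁² = 1∕g₀² + β₁(g₀)` is injective in `g₀` on the small
box).  The rev-1 cut may instead index the run-B functional by the cutoff (`EB : ℕ → Functional`) chain-wide.

One finite four-torus at fixed ε, rung (B)+1; NOT infinite volume, NOT OS on ℝ⁴, NOT a mass gap, NOT Clay.  `SRec`, `RRec` are PARAMETERS (no
carrier of record exists in the tree); nothing of Bałaban's is asserted or instantiated; N19 is NOT discharged; count-neutral.  THEOREMS ONLY;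
0 sorry; standard axioms.
-/

set_option autoImplicit false

noncomputable section

open Finset MeasureTheory
open scoped BigOperators

namespace Summit.QuantumFields.YangMills.BalabanUVNodes.N19RateEdge

open Literature.MathematicalPhysics.QuantumFieldTheory.Balaban1983to89
open T4OutputRate T4RecentScale T4GoodClassBudget T4CauchySum T4TowerRateComposition T4TowerRateDischarge
open T4EtaRateMin (Readings NE3Shape)
open T4RateLiaison (GaugeDominated)
open TreeLengthTorus (TFaceConnected torusTreeLen)
open B12TreeDecay (kappa₀)
open Summit.QuantumFields.BalabanUV.T4Continuum.Spine
open Summit.QuantumFields.BalabanUV.T4Continuum.NE1p.DressedRoot (DressedTower DressedStabilityStrict)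
open Summit.QuantumFields.YangMills.BalabanUVNodes.N19LedgerLinkSync (LedgerDataSync LedgerAtSync)
open Summit.QuantumFields.YangMills.BalabanUVNodes.N19MultiplicityByName (core_summable_of_ledgerAtSync_multByName)
open Summit.QuantumFields.YangMills.BalabanUVNodes.N19AtSpineCarriers (deltaOfRecord s_N19_of_coreEdge)
open YMDAG.UVSplit (SpineCarriers SpineRecordPred U3Carriers RateCarriers RateRecordPred N14At N18At N22At RatesAt RateInputs S_N19)

/-! ## §1 Adapters from module 2's node readings [bookkeeping] -/

/-- **N18 AT A SELECTED FIRST COUPLING.**  `N18At u` — NE5 at every member `u.EB b`, `b ∈ ]0, γ]`, of run B's first-coupling family — gives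
NE5 for the SINGLE functional `s ↦ u.EB (bsel s) s` of any selector `bsel` mapping the window into `]0, γ]` (the knit chain's letter). [folklore] -/
theorem ne5_of_n18At (u : U3Carriers) (h : N18At u) (bsel : (ℕ → ℝ) → ℝ) (hb : ∀ s ∈ u.W, 0 < bsel s ∧ bsel s ≤ u.γ) :
    NE5 u.EA (fun s => u.EB (bsel s) s) u.W u.κ u.θ u.C₅ :=
  fun s hs U X => h (bsel s) (hb s hs).1 (hb s hs).2 s hs U X

/-- `N14At` is N14's root of record on the bundle's tower (definitional). [folklore] -/
theorem dressedStabilityStrict_of_n14At {c : YMDAG.UVSplit.NE1pCarriers} (h : N14At c) : DressedStabilityStrict c.𝒯 c.Λ := h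

/-! ## §2 The rate edge from a link reading of `(S, R)` and `RatesAt D R` by name -/

section Edge

variable {N : ℕ} [NeZero N]

/-- **THE N19′ RATE EDGE AT THE TWO CARRIER RECORDS** [bookkeeping].  IF the record predicates hand, for every pair `(S, R)` they pin, the
LINK READING of the module docstring — ledger data `L` over `R.u3.C` indexed by `S.ι`, a field space with NE3's readings family `Rd`, a
first-coupling selector `bsel` with the run-B functional `EB = s ↦ R.u3.EB (bsel s) s`, coupling tables `g`, background maps `uA uB`, the
bracket data `CU Pg q`, liaison letters `θc Cd C₃ θ₃`, the census set-ups `Pf, cells`, the printed family `fam` of (2.43) with its letters,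
N14's count rate `(N₀, Λ₀ ≤ R.ne1.Λ)`, a `dressed` mark — satisfying (i) `LedgerAtSync` for whatever size∕census data meet their clauses,
`0 ≤ S.vol`, the U5b ledger's own window census and base letters; (ii) identifications (m), (v-A), (v-B), (d); (iii) `B14.Thm2Printed`;
(iv) the positional counts of `R.ne1.𝒯`; (v) liaison N16 (`NE3Shape` + `GaugeDominated`), letter signs, liaison N17 (`InjectedRate` + box),
(T), window memberships, selector compatibility — THEN for all `F D g₀ os S R`: `SRec … S → RRec … R → RatesAt D R →
∃ δ, NE7.Core S.l₀ S.vol S.T S.Bad (A − shA) (B − shB) δ ∧ Summable δ` (N14 · N18 · N22 from `RatesAt` BY NAME; v6 BY NAME).  The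
hypothesis of `BalabanUVNodesN27SpineRecord.coreEdge_of_rateEdge`.  NOT NE7; N19 NOT discharged. [folklore] -/
theorem rateEdge_of_linkReading (SRec : SpineRecordPred N) (RRec : RateRecordPred N)
    (hlink : ∀ (F : T4Continuum.T4Family) (D : YMDAG.UVSplit.Datum F N) (g₀ : ℕ → ℝ) (os : List (T4Continuum.ULoop F))
      (S : SpineCarriers) (R : RateCarriers N), SRec F D g₀ os S → RRec F D g₀ os R → letI := S.dec
      ∃ (_ : DecidableEq R.u3.C.Dom) (F' : Type) (ι' X' : Type) (_ : MeasurableSpace ι')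
        (L : LedgerDataSync R.u3.C F' ι' S.ι) (Rd : Readings ι' X') (bsel : (ℕ → ℝ) → ℝ) (EB : Functional R.u3.C R.u3.C.BgB)
        (θc Cd C₃ θ₃ Pg : ℝ) (q : ℕ) (CU : (ℕ → ℝ) → ℕ → ℝ) (g : ℕ → ℕ → ℝ)
        (uA : ℕ → ι' → R.u3.C.BgA) (uB : ℕ → ι' → R.u3.C.BgB)
        (Pf : ℕ → Params) (d₀ L₀ Koff : ℕ) (cells : (K j : ℕ) → R.u3.C.Dom → Finset (Site (Pf K) j))
        (H033 : Flow → ℕ → Prop) (I : Type) (fam : I → B14.Sect2Data) (Lb β : ℝ) (κ₁ : ℕ) (Gv Cl : ℝ) (K₁ : ℕ)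
        (Λ₀ N₀ : ℝ) (dressed : R.u3.C.Dom → Prop) (_ : DecidablePred dressed),
        -- the run-B functional is the first-coupling family read through the selector
        EB = (fun s => R.u3.EB (bsel s) s) ∧
        -- (i) the ledger predicate for whatever size data and census constants meet their clauses
        (∀ (Sz : ℕ → ℝ → S.ι → ℕ → ℝ) (E₀ : ℝ) (m : ℕ) (a : ℝ) (Cw Λg : ℝ),
          (∀ K t, |t| ≤ S.l₀ → ∀ τ ∈ S.T K \ S.Bad K t, ∀ v ∈ Rd.dom, ∀ j ≤ K,
            |∑ X ∈ L.fac K t τ with R.u3.C.scale X = j,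
                (Real.log (Real.exp (EB (fun i => g (K + 1) (i + 1)) (uB K v) X
                    - EB (fun i => g (K + 1) (i + 1)) L.oneB X))
                  - Real.log (Real.exp (R.u3.EA (g K) (uA K v) X - R.u3.EA (g K) L.oneA X)))| ≤ Sz K t τ j) →
          0 ≤ E₀ → 0 < a → a < 1 →
          (∀ K t, |t| ≤ S.l₀ → ∀ τ ∈ S.T K \ S.Bad K t, ∀ j ≤ K,
            Sz K t τ j ≤ S.vol * (E₀ * ((K : ℝ) + 1) ^ m * a ^ (K - j))) →
          (∀ K, Multiplicity (L.All K) R.u3.C.scale (fun X => Real.exp (-(R.u3.κ * R.u3.C.d X))) Cw S.vol Λg K) →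
          (∀ K t, |t| ≤ S.l₀ → ∀ τ ∈ S.T K \ S.Bad K t,
            WindowMultiplicity (L.facO K t τ) L.scO L.wO Cw S.vol Λg (jlogOf L.Cl K) K) →
          1 ≤ Λg → L.θ' ≤ Λg →
          LedgerAtSync { L with S := Sz, E₀ := E₀, m := m, a := a, Cw := Cw, Λg := Λg } S.l₀ S.vol S.T S.Bad
            (fun K t τ => S.A K t τ - S.shA K t τ) (fun K t τ => S.B K t τ - S.shB K t τ) Rd R.u3.EA EB R.u3.κ g uA uB
            R.u3.ω θc R.u3.θ θ₃) ∧
        0 ≤ S.vol ∧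
        (∀ K t, |t| ≤ S.l₀ → ∀ τ ∈ S.T K \ S.Bad K t,
          WindowMultiplicity (L.facO K t τ) L.scO L.wO L.Cw S.vol L.Λg (jlogOf L.Cl K) K) ∧
        0 ≤ L.Cw ∧ 1 ≤ L.Λg ∧ L.θ' ≤ L.Λg ∧
        -- (ii-m) the reference ledger's lattice identification
        (∀ K, (Pf K).d = d₀) ∧ (∀ K, (Pf K).L = L₀) ∧ (∀ K, (Pf K).K = Koff + K) ∧
        (∀ K, (Fintype.card (Site (Pf K) (Pf K).K) : ℝ) = S.vol) ∧
        kappa₀ (4 * 2 ^ d₀) (2 * d₀) ≤ R.u3.κ ∧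
        (∀ K, ∀ X ∈ L.All K,
          (cells K (R.u3.C.scale X + Koff) X).Nonempty ∧ TFaceConnected (cells K (R.u3.C.scale X + Koff) X)) ∧
        (∀ K j, Set.InjOn (cells K j) ↑((L.All K).filter fun X => R.u3.C.scale X + Koff = j)) ∧
        (∀ K, ∀ X ∈ L.All K, torusTreeLen (cells K (R.u3.C.scale X + Koff) X) ≤ R.u3.C.d X) ∧
        -- (iii) [III] Theorem 2 (2.43) AS PRINTED with window letters
        B14.Thm2Printed H033 fam Lb β κ₁ ∧ β < 1 ∧ 0 < β ∧ 1 < Lb ∧ 1 ≤ Gv ∧ 0 ≤ Cl ∧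
        -- (iv) the positional-count half of N14's pinned pair at a rate `≤ R.ne1.Λ`
        (∀ p K, (R.ne1.𝒯.B p K).PositionalCount fun j k => N₀ * Λ₀ ^ (k - j)) ∧ 0 ≤ N₀ ∧ 0 ≤ Λ₀ ∧ Λ₀ ≤ R.ne1.Λ ∧
        -- (ii-v-A) run A's vacuum slices ↔ printed E-terms
        (∀ K t, |t| ≤ S.l₀ → ∀ τ ∈ S.T K \ S.Bad K t, ∀ v ∈ Rd.dom, ∀ j ≤ K, ∃ (i : I) (w : (fam i).Ω) (j' : ℕ),
          (fam i).flow.SatisfiesRG (fam i).K ∧ H033 (fam i).flow (fam i).K ∧ 1 ≤ j' ∧ j' ≤ (fam i).K ∧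
          (fam i).K - j' = K - j ∧ (fam i).K ≤ K + K₁ ∧
          (∀ n, 0 ≤ (fam i).gammaVol n w) ∧ (fam i).gammaVol (fam i).K w ≤ S.vol ∧
          (∀ n, n < (fam i).K → n < jlogOf Cl (fam i).K → (fam i).gammaVol n w = 0) ∧
          (∀ n, n < (fam i).K → jlogOf Cl (fam i).K ≤ n → (fam i).gammaVol n w ≤ S.vol * Gv ^ ((fam i).K - n)) ∧
          |∑ X ∈ (L.fac K t τ).filter (fun X => ¬ dressed X) with R.u3.C.scale X = j,
              (R.u3.EA (g K) (uA K v) X - R.u3.EA (g K) L.oneA X)| ≤ |(fam i).eTerm j' (fam i).K w|) ∧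
        -- (ii-v-B) run B's vacuum slices ↔ printed E-terms
        (∀ K t, |t| ≤ S.l₀ → ∀ τ ∈ S.T K \ S.Bad K t, ∀ v ∈ Rd.dom, ∀ j ≤ K, ∃ (i : I) (w : (fam i).Ω) (j' : ℕ),
          (fam i).flow.SatisfiesRG (fam i).K ∧ H033 (fam i).flow (fam i).K ∧ 1 ≤ j' ∧ j' ≤ (fam i).K ∧
          (fam i).K - j' = K - j ∧ (fam i).K ≤ K + K₁ ∧
          (∀ n, 0 ≤ (fam i).gammaVol n w) ∧ (fam i).gammaVol (fam i).K w ≤ S.vol ∧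
          (∀ n, n < (fam i).K → n < jlogOf Cl (fam i).K → (fam i).gammaVol n w = 0) ∧
          (∀ n, n < (fam i).K → jlogOf Cl (fam i).K ≤ n → (fam i).gammaVol n w ≤ S.vol * Gv ^ ((fam i).K - n)) ∧
          |∑ X ∈ (L.fac K t τ).filter (fun X => ¬ dressed X) with R.u3.C.scale X = j,
              (EB (fun i => g (K + 1) (i + 1)) (uB K v) X - EB (fun i => g (K + 1) (i + 1)) L.oneB X)|
            ≤ |(fam i).eTerm j' (fam i).K w|) ∧
        -- (ii-d) the dressed sub-ledger ↔ N14's bookings on `R.ne1.𝒯`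
        (∀ K t, |t| ≤ S.l₀ → ∀ τ ∈ S.T K \ S.Bad K t, ∀ v ∈ Rd.dom,
          ∃ (pA : R.ne1.P) (βA : R.u3.C.Dom → (R.ne1.𝒯.B pA K).Birth) (Q : Finset (R.ne1.𝒯.B pA K).Cube) (pB : R.ne1.P)
            (KB : ℕ) (βB : R.u3.C.Dom → (R.ne1.𝒯.B pB KB).Birth),
          (∀ X ∈ (L.fac K t τ).filter (fun X => dressed X), (R.ne1.𝒯.B pA K).birthScale (βA X) = R.u3.C.scale X) ∧
          (∀ j, Set.InjOn βA ↑(((L.fac K t τ).filter (fun X => dressed X)).filter fun X => R.u3.C.scale X = j)) ∧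
          (∀ c ∈ Q, (R.ne1.𝒯.B pA K).cubeScale c = K) ∧ ((Q.card : ℝ) ≤ S.vol) ∧
          (∀ X ∈ (L.fac K t τ).filter (fun X => dressed X), ∃ c ∈ Q, βA X ∈ (R.ne1.𝒯.B pA K).feltAt c) ∧
          (∀ X ∈ (L.fac K t τ).filter (fun X => dressed X), KB - (R.ne1.𝒯.B pB KB).birthScale (βB X) = K - R.u3.C.scale X) ∧
          (∀ X ∈ (L.fac K t τ).filter (fun X => dressed X),
            |R.u3.EA (g K) (uA K v) X - R.u3.EA (g K) L.oneA X| ≤ (R.ne1.𝒯.B pA K).size (βA X) K) ∧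
          (∀ X ∈ (L.fac K t τ).filter (fun X => dressed X),
            |EB (fun i => g (K + 1) (i + 1)) (uB K v) X - EB (fun i => g (K + 1) (i + 1)) L.oneB X|
              ≤ (R.ne1.𝒯.B pB KB).size (βB X) KB)) ∧
        -- (v) liaison N16, letter signs, liaison N17, (T), window memberships, selector compatibility
        NE3Shape Rd C₃ θ₃ ∧ 0 ≤ C₃ ∧ GaugeDominated Rd uA uB ∧
        0 ≤ R.u3.θ ∧ 0 ≤ R.u3.C₅ ∧ 0 ≤ R.u3.ω ∧
        InjectedRate Cd 0 θc (fun K j => T4CouplingMatching.disc (g K) (g (K + 1)) j) ∧ 0 ≤ Cd ∧ 0 ≤ θc ∧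
        (∀ K i, i ≤ K → 0 < g K i ∧ g K i ≤ R.u3.γ) ∧
        LipBackground R.u3.EA R.u3.W R.u3.κ CU ∧ PolyLipGrowth CU g Pg q ∧ 0 ≤ Pg ∧
        (∀ K, g K ∈ R.u3.W) ∧ (∀ K, (fun i => g (K + 1) (i + 1)) ∈ R.u3.W) ∧
        (∀ s ∈ R.u3.W, 0 < bsel s ∧ bsel s ≤ R.u3.γ)) :
    ∀ (F : T4Continuum.T4Family) (D : YMDAG.UVSplit.Datum F N) (g₀ : ℕ → ℝ) (os : List (T4Continuum.ULoop F))
      (S : SpineCarriers) (R : RateCarriers N), SRec F D g₀ os S → RRec F D g₀ os R → RatesAt D R → letI := S.dec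
      ∃ δ : ℕ → ℝ, NE7.Core S.l₀ S.vol S.T S.Bad (fun K t τ => S.A K t τ - S.shA K t τ)
        (fun K t τ => S.B K t τ - S.shB K t τ) δ ∧ Summable δ := by
  intro F D g₀ os S R hS hR hrates
  letI := S.dec
  obtain ⟨_, F', ι', X', _, L, Rd, bsel, EB, θc, Cd, C₃, θ₃, Pg, q, CU, g, uA, uB, Pf, d₀, L₀, Koff, cells, H033, I, fam, Lb, β,
    κ₁, Gv, Cl, K₁, Λ₀, N₀, dressed, _, hEB, hL, hvol, homult, hCw, hΛg, hθΛ, hPd, hPL, hPK, hcard, hκ₀, hdom, hinj, hlen, h11,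
    hβ1, hβ0, hLb, hGv, hCl, hcount, hN₀, hΛ₀, hle, hidA, hidB, hidD, h16, hC₃, hgd, hθ, hC₅, hω, hinj17, hCd, hθc, hbox, hU,
    hG, hPg, hgA, hgB, hbsel⟩ := hlink F D g₀ os S R hS hR
  -- the three in-edges consumed from `RatesAt D R` by name
  have h14 : DressedStabilityStrict R.ne1.𝒯 R.ne1.Λ := dressedStabilityStrict_of_n14At hrates.1
  have h18 : NE5 R.u3.EA EB R.u3.W R.u3.κ R.u3.θ R.u3.C₅ := by
    rw [hEB]; exact ne5_of_n18At R.u3 hrates.2.2.2.2.1 bsel hbsel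
  have h22 : NE9 R.u3.EA R.u3.W R.u3.κ R.u3.Λ ∧ T4OutputRate.FadingMemory R.u3.C₉ R.u3.ω R.u3.Λ := hrates.2.2.2.2.2
  exact core_summable_of_ledgerAtSync_multByName hL hvol homult hCw hΛg hθΛ Pf hPd hPL hPK hcard hκ₀ cells hdom hinj hlen
    H033 fam h11 hβ1 hβ0 hLb hGv hCl K₁ ⟨h14, hcount⟩ hN₀ hΛ₀ hle dressed hidA hidB hidD h16 hC₃ hgd h18 hθ hC₅ h22 hω hinj17
    hCd hθc hbox hU hG hPg hgA hgB

end Edge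

/-! ## §3 The K5 stub at K4's instantiated hook `RateInputs RRec` from the rate edge (interim pin of `N19AtSpineCarriers`) -/

section Stub

variable {N : ℕ} [NeZero N]

/-- **`S_N19 SRec (RateInputs RRec)` FROM THE RATE EDGE** [bookkeeping]: the interim remainder pin of `N19AtSpineCarriers` (`S.δ = deltaOfRecord …`,
referee pin of record: U4′'s δ-half content-free under it) and the N19′ rate edge at the two carrier records give the landed K5 stub at module 2's
hook `Inputs := RateInputs RRec` (`s_N19_of_coreEdge`; `RateInputs` unpacked).  Compose with `rateEdge_of_linkReading`. [folklore] -/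
theorem s_N19_rateInputs_of_rateEdge (SRec : SpineRecordPred N) (RRec : RateRecordPred N)
    (hpin : ∀ (F : T4Continuum.T4Family) (D : YMDAG.UVSplit.Datum F N) (g₀ : ℕ → ℝ) (os : List (T4Continuum.ULoop F))
      (S : SpineCarriers), SRec F D g₀ os S → letI := S.dec
      S.δ = deltaOfRecord S.l₀ S.vol S.T S.Bad (fun K t τ => S.A K t τ - S.shA K t τ) (fun K t τ => S.B K t τ - S.shB K t τ))
    (hedge : ∀ (F : T4Continuum.T4Family) (D : YMDAG.UVSplit.Datum F N) (g₀ : ℕ → ℝ) (os : List (T4Continuum.ULoop F))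
      (S : SpineCarriers) (R : RateCarriers N), SRec F D g₀ os S → RRec F D g₀ os R → RatesAt D R → letI := S.dec
      ∃ δ : ℕ → ℝ, NE7.Core S.l₀ S.vol S.T S.Bad (fun K t τ => S.A K t τ - S.shA K t τ)
        (fun K t τ => S.B K t τ - S.shB K t τ) δ ∧ Summable δ) :
    S_N19 SRec (RateInputs RRec) :=
  s_N19_of_coreEdge SRec (RateInputs RRec) hpin fun F D g₀ os S hS hI => by
    obtain ⟨R, hR, hrates⟩ := hI
    exact hedge F D g₀ os S R hS hR hrates

end Stub

end Summit.QuantumFields.YangMills.BalabanUVNodes.N19RateEdge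

end
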